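import Summits.CriticalPhenomena.PercolationContinuityZ3.Theorems.PercNearOneGluingNoHeavyRsw3InvasionCheckedLabels
import HarnessLib

/-!
# RSW3 lane (P2, gen 27): INVASION PERCOLATION XVII — GLIVENKO–CANTELLI FOR THE CHECKED LABELS:
# `sup_{y ∈ [0,1]} |#{checked ≤ y}/L_n − y| → 0` almost surely (CCN's Proposition 2.1, uniform form)

builds on p205010 (kernel theorem, internal audit signed; external expert review pending) — NOT used in this file.

Cell `prim-rsw3`, prover seat `prim-rsw3-p2` (gen 27), memo `run/shared/lean/prim/rsw3/P2-RSWLITE.md` §34.  Support file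
(`--supports stmt-CriticalPhenomena-4575`); no definitions, no named facts, no sorries.  Notation of files XIV–XV: `E(I_n)` the checked edges,
`L_n = |E(I_n)|`, `F_n(y) = #{e ∈ E(I_n) : U_e ≤ y}/L_n` the empirical distribution function of the checked labels (CCN's `P_n(y)`).

File XV proved `F_n(y) → y` almost surely for each fixed `y ∈ [0,1]`.  Since `F_n` is non-decreasing in `y` and the limit `y ↦ y` is continuous,
the classical Glivenko–Cantelli sandwich over the grid `{i/(m+1)}` upgrades this to UNIFORM convergence on `[0,1]`, almost surely.

* `checkedFraction_mono` — `y ≤ y' ⇒ F_n(y) ≤ F_n(y')`.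
* **`ae_forall_eventually_forall_abs_checkedFraction_sub_le`** — almost surely: for every `ε > 0`, for all large `n`, `|F_n(y) − y| ≤ ε` for ALL
  `y ∈ [0,1]` simultaneously (every infinite connected graph of bounded degree); `…_zd` — the `ℤ^d` instance.

References: J. T. Chayes, L. Chayes, C. M. Newman, Comm. Math. Phys. 101 (1985) 383–407, Prop. 2.1 [ChayesChayesNewman1985] (uniformity: the
Glivenko–Cantelli argument, folklore).
-/

noncomputable section

namespace Summit.CriticalPhenomena.PercolationContinuityZ3.Theorems.Rsw3

open Finset MeasureTheory Filter Topology Literature.Probability.Percolation Literature.Probability.Percolation.Invasion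
open scoped ENNReal

variable {V : Type*} [DecidableEq V] {G : SimpleGraph V} [G.LocallyFinite]

omit [DecidableEq V] [G.LocallyFinite] in
/-- The empirical distribution function of the checked labels is non-decreasing in the level. [folklore] -/
theorem checkedFraction_mono (E : Finset (Sym2 V)) (U : Sym2 V → ℝ) {y y' : ℝ} (h : y ≤ y') :
    ((E.filter fun e => U e ≤ y).card : ℝ) / E.card ≤ ((E.filter fun e => U e ≤ y').card : ℝ) / E.card := by
  refine div_le_div_of_nonneg_right ?_ (Nat.cast_nonneg _)
  exact_mod_cast card_le_card fun e he => by rw [mem_filter] at he ⊢; exact ⟨he.1, he.2.trans h⟩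

/-- The Glivenko–Cantelli sandwich: if `F` is non-decreasing, `|F(i/(m+1)) − i/(m+1)| ≤ δ` for `i = 0, …, m+1`, then
`|F(y) − y| ≤ δ + 1/(m+1)` for every `y ∈ [0,1]`. [folklore] -/
theorem abs_sub_le_of_grid {F : ℝ → ℝ} (hF : Monotone F) {m : ℕ} {δ : ℝ}
    (hgrid : ∀ i : ℕ, i ≤ m + 1 → |F ((i : ℝ) / (m + 1)) - (i : ℝ) / (m + 1)| ≤ δ) {y : ℝ} (hy0 : 0 ≤ y) (hy1 : y ≤ 1) :
    |F y - y| ≤ δ + 1 / (m + 1) := by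
  have hm : (0 : ℝ) < m + 1 := by positivity
  -- the grid cell of `y`
  set i : ℕ := min ⌊y * (m + 1)⌋₊ m with hi
  have him : i ≤ m := min_le_right _ _
  have hfloor : (⌊y * (m + 1)⌋₊ : ℝ) ≤ y * (m + 1) := Nat.floor_le (by positivity)
  have hlo : (i : ℝ) / (m + 1) ≤ y := by
    rw [div_le_iff₀ hm]
    have hle : i ≤ ⌊y * (m + 1)⌋₊ := min_le_left _ _
    have : (i : ℝ) ≤ ⌊y * (m + 1)⌋₊ := by exact_mod_cast hle
    linarith
  have hhi : y ≤ ((i : ℝ) + 1) / (m + 1) := by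
    rw [le_div_iff₀ hm]
    rcases lt_or_ge ⌊y * (m + 1)⌋₊ m with hlt | hge
    · have hieq : i = ⌊y * (m + 1)⌋₊ := min_eq_left hlt.le
      rw [hieq]
      exact (Nat.lt_floor_add_one (y * (m + 1))).le
    · have hieq : i = m := min_eq_right hge
      rw [hieq]
      nlinarith
  have h1 := hgrid i (by omega)
  have h2 := hgrid (i + 1) (by omega)
  have hup : F y - y ≤ δ + 1 / (m + 1) := by
    have hFy : F y ≤ F (((i + 1 : ℕ) : ℝ) / (m + 1)) := hF (by push_cast; exact hhi)
    have := (abs_le.1 h2).2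
    have hgap : (((i + 1 : ℕ) : ℝ)) / (m + 1) - (i : ℝ) / (m + 1) = 1 / (m + 1) := by push_cast; ring
    linarith
  have hdown : -(δ + 1 / (m + 1)) ≤ F y - y := by
    have hFy : F ((i : ℝ) / (m + 1)) ≤ F y := hF hlo
    have := (abs_le.1 h1).1
    have hgap : ((i : ℝ) + 1) / (m + 1) - (i : ℝ) / (m + 1) = 1 / (m + 1) := by ring
    linarith
  exact abs_le.2 ⟨hdown, hup⟩

variable [Countable V]

/-- **GLIVENKO–CANTELLI FOR THE CHECKED LABELS** (CCN's Proposition 2.1, uniform form): on an infinite connected graph of degrees `≤ Δ`, almost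
surely, for every `ε > 0` and all large `n`, `|#{e ∈ E(I_n) : U_e ≤ y}/L_n − y| ≤ ε` for ALL `y ∈ [0,1]` at once.
[cite: ChayesChayesNewman1985, Prop. 2.1 (P_n → uniform distribution function)] -/
theorem ae_forall_eventually_forall_abs_checkedFraction_sub_le [Infinite V] (hG : G.Preconnected) {Δ : ℕ} (hΔ : ∀ v, G.degree v ≤ Δ) (o : V) :
    ∀ᵐ U ∂(labelMeasure V), ∀ ε : ℝ, 0 < ε → ∀ᶠ n : ℕ in atTop, ∀ y ∈ Set.Icc (0 : ℝ) 1,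
      |((((invasion G U o n).biUnion fun v => G.incidenceFinset v).filter fun e => U e ≤ y).card : ℝ)
          / ((invasion G U o n).biUnion fun v => G.incidenceFinset v).card - y| ≤ ε := by
  -- pointwise convergence at all grid points `i/(m+1)`, simultaneously
  have hgrid : ∀ᵐ U ∂(labelMeasure V), ∀ m i : ℕ, i ≤ m + 1 → Tendsto (fun n : ℕ =>
      ((((invasion G U o n).biUnion fun v => G.incidenceFinset v).filter fun e => U e ≤ (i : ℝ) / (m + 1)).card : ℝ)
        / ((invasion G U o n).biUnion fun v => G.incidenceFinset v).card) atTop (𝓝 ((i : ℝ) / (m + 1))) := by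
    refine ae_all_iff.2 fun m => ae_all_iff.2 fun i => ?_
    by_cases him : i ≤ m + 1
    · have h0 : (0 : ℝ) ≤ (i : ℝ) / (m + 1) := by positivity
      have h1 : (i : ℝ) / (m + 1) ≤ 1 := by
        rw [div_le_one (by positivity)]; exact_mod_cast him
      filter_upwards [ae_tendsto_checkedFraction hG hΔ o h0 h1] with U hU _ using hU
    · exact Eventually.of_forall fun U h => absurd h him
  filter_upwards [hgrid] with U hU ε hε
  obtain ⟨m, hm⟩ := exists_nat_one_div_lt (half_pos hε)
  -- eventually all `m + 2` grid deviations are `≤ ε/2`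
  have hev : ∀ᶠ n : ℕ in atTop, ∀ i ∈ Finset.range (m + 2),
      |((((invasion G U o n).biUnion fun v => G.incidenceFinset v).filter fun e => U e ≤ (i : ℝ) / (m + 1)).card : ℝ)
          / ((invasion G U o n).biUnion fun v => G.incidenceFinset v).card - (i : ℝ) / (m + 1)| ≤ ε / 2 := by
    refine (eventually_all_finset _).2 fun i hi => ?_
    have h := hU m i (by have := mem_range.1 hi; omega)
    exact (Metric.tendsto_nhds.1 h (ε / 2) (half_pos hε)).mono fun n hn => by rw [Real.dist_eq] at hn; exact hn.le
  filter_upwards [hev] with n hn y hy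
  set E := (invasion G U o n).biUnion fun v => G.incidenceFinset v with hE
  have hmono : Monotone fun z : ℝ => ((E.filter fun e => U e ≤ z).card : ℝ) / E.card :=
    fun z z' h => checkedFraction_mono E U h
  have h := abs_sub_le_of_grid hmono (m := m) (δ := ε / 2) (fun i hi => hn i (mem_range.2 (by omega))) hy.1 hy.2
  have : (1 : ℝ) / (m + 1) < ε / 2 := by
    have : (1 : ℝ) / ((m : ℝ) + 1) = 1 / ((m + 1 : ℕ) : ℝ) := by push_cast; ring
    linarith [hm]
  linarith

/-! ## The `ℤ^d` instance -/

section Zd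

open Literature.Probability.LatticeModels

variable {d : ℕ}

/-- **Glivenko–Cantelli for the labels checked by the invasion of `ℤ^d`** (`d ≥ 1`): almost surely, for every `ε > 0` and all large `n`,
`|#{e ∈ E(I_n) : U_e ≤ y}/L_n − y| ≤ ε` for all `y ∈ [0,1]`. [cite: ChayesChayesNewman1985, Prop. 2.1] -/
theorem ae_forall_eventually_forall_abs_checkedFraction_sub_le_zd (hd : 1 ≤ d) :
    ∀ᵐ U ∂(labelMeasure (Site d)), ∀ ε : ℝ, 0 < ε → ∀ᶠ n : ℕ in atTop, ∀ y ∈ Set.Icc (0 : ℝ) 1,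
      |((((invasion (zdGraph d) U 0 n).biUnion fun v => (zdGraph d).incidenceFinset v).filter fun e => U e ≤ y).card : ℝ)
          / ((invasion (zdGraph d) U 0 n).biUnion fun v => (zdGraph d).incidenceFinset v).card - y| ≤ ε := by
  haveI : Nonempty (Fin d) := ⟨⟨0, hd⟩⟩
  haveI : Infinite (Site d) := Pi.infinite_of_right
  have hΔ : ∀ v : Site d, (zdGraph d).degree v ≤ 2 * d := fun v => by
    rw [← SimpleGraph.card_neighborFinset_eq_degree, card_neighborFinset_zdGraph_holds v]
  exact ae_forall_eventually_forall_abs_checkedFraction_sub_le zdGraph_preconnected_holds hΔ 0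

end Zd

end Summit.CriticalPhenomena.PercolationContinuityZ3.Theorems.Rsw3

end
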